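import Literature.MathematicalPhysics.QuantumFieldTheory.Balaban1983to89.B9AdOrthogonal
import Literature.MathematicalPhysics.QuantumFieldTheory.Balaban1983to89.Beta.ColourTrace

/-!
# `BalabanUV.Beta.ColourBasisSU` — **AN EXPLICIT COMPLETE, TR-ORTHONORMAL COLOUR FAMILY FOR EVERY `N`** (β sub-cell, row BETA-an3,
# lineage an3 gen 32; a service module for every β-side END that carries `(hτ : Complete τ) (ho : TrOrthonormal τ) (c : C)`)

HONEST FRAMING (cell charter, verbatim): «discharging BetaPertH makes Balaban's UV stability UNCONDITIONAL — a real
constructive-QFT result; it is NOT the continuum limit and NOT the Clay problem.»  Neutral finite linear algebra ([folklore]); no statement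
of Bałaban's papers, no `[cite:]`, no `Prop` fact; instantiates no binder of the wall.  NOT D1, NOT `BetaPertH`, NOT continuum, NOT Clay.

PURPOSE.  Many β-side kernel identities (the Wilson first/second-order reflection laws `WilsonReflectionContact.wilsonA_bref`,
`WilsonReflectionContact2.wilsonW₂_wsym22_bref`, `WilsonLetterSocketFit.*`, the plaquette-trace tables …) are stated for an ARBITRARY
generator family `τ : C → Matrix (Fin N) (Fin N) ℂ` under the two family predicates of `Beta.ColourTrace` — `Complete τ` (index-form Fierz
identity `Σ_c τ_c ⊗ τ_c = N·swap − 1 ⊗ 1`) and `TrOrthonormal τ` (`Tr τ_c τ_d = N·δ_cd`) — and an external colour `c : C`, although their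
conclusions mention `N` only.  The tree's `B9AdOrthogonal` (§GellMann) has the EXPLICIT generalized Gell-Mann family
`gellMann : GMIndex N → Matrix (Fin N) (Fin N) ℂ` — hermitian, traceless, orthonormal for `Re Tr XY` and complete on the hermitian traceless
matrices.  This file bridges the two conventions: the rescaled family `suGen N a := √N · gellMann a` is `TrOrthonormal` AND `Complete` in the
`ColourTrace` sense, for EVERY `N` (§2), via the complex-linear expansion of an arbitrary traceless matrix in the Gell-Mann family (§1,
hermitian/anti-hermitian split); and `GMIndex N` is inhabited for `2 ≤ N` (§3).  So every such END can be read colour-hypothesis-free at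
`τ := suGen N`.  Provenance: β sub-cell, unit beta-an3 gen 32, 2026-08-20 (v1); no existing file touched.
-/

namespace Summit.QuantumFields.BalabanUV.Beta.ColourBasisSU

open Matrix
open Literature.MathematicalPhysics.QuantumFieldTheory.Balaban1983to89
open Literature.MathematicalPhysics.QuantumFieldTheory.Balaban1983to89.B9AdOrthogonal (GMIndex gellMann gellMann_mem gellMann_orth
  gellMann_complete form_apply im_trace_mul_eq_zero)
open Literature.MathematicalPhysics.QuantumFieldTheory.Balaban1983to89.Beta.ColourTrace (Complete TrOrthonormal complete_of_expansion)

variable {N : ℕ}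

/-! ## §1 The Gell-Mann family: complex traces and the expansion of every traceless matrix -/

/-- [folklore] `Tr (gellMann a · gellMann b) = δ_ab` as a COMPLEX number (real part: `gellMann_orth`; imaginary part: both hermitian). -/
theorem trace_gellMann_mul_gellMann (a b : GMIndex N) :
    trace (gellMann a * gellMann b) = if a = b then (1 : ℂ) else 0 := by
  have hre : (trace (gellMann a * gellMann b)).re = if a = b then (1 : ℝ) else 0 := by
    have h := gellMann_orth a b
    rw [form_apply, one_mul] at h
    exact h
  have him : (trace (gellMann a * gellMann b)).im = 0 := im_trace_mul_eq_zero (gellMann_mem a).1 (gellMann_mem b).1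
  apply Complex.ext
  · rw [hre]; split_ifs <;> simp
  · rw [him]; split_ifs <;> simp

/-- [folklore] For HERMITIAN `X`, `Tr (X · gellMann a)` is real: it equals the (real) trace-form coefficient `form 1 (gellMann a) X`. -/
theorem trace_mul_gellMann_of_isHermitian {X : Matrix (Fin N) (Fin N) ℂ} (hX : X.IsHermitian) (a : GMIndex N) :
    trace (X * gellMann a) = ((B9AdOrthogonal.form 1 (gellMann a) X : ℝ) : ℂ) := by
  rw [form_apply, one_mul, Matrix.trace_mul_comm]
  apply Complex.ext
  · simp
  · rw [Complex.ofReal_im]; exact im_trace_mul_eq_zero (gellMann_mem a).1 hX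

/-- [folklore] EXPANSION OF A HERMITIAN TRACELESS MATRIX with complex trace coefficients: `Σ_a Tr(X·λ_a) • λ_a = X`. -/
theorem gellMann_expansion_of_isHermitian {X : Matrix (Fin N) (Fin N) ℂ} (hX : X.IsHermitian) (hX0 : trace X = 0) :
    ∑ a, trace (X * gellMann a) • gellMann a = X := by
  conv_rhs => rw [← gellMann_complete X hX hX0]
  refine Finset.sum_congr rfl fun a _ => ?_
  rw [trace_mul_gellMann_of_isHermitian hX, Complex.coe_smul]

/-- [folklore] The hermitian part `½(Z + Zᴴ)` is hermitian. -/
theorem isHermitian_hermPart (Z : Matrix (Fin N) (Fin N) ℂ) : ((1 / 2 : ℂ) • (Z + Zᴴ)).IsHermitian := by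
  unfold Matrix.IsHermitian
  rw [conjTranspose_smul, conjTranspose_add, conjTranspose_conjTranspose, add_comm]
  congr 1
  simp

/-- [folklore] The rotated anti-hermitian part `−(i/2)(Z − Zᴴ)` is hermitian. -/
theorem isHermitian_skewPart (Z : Matrix (Fin N) (Fin N) ℂ) : ((-(Complex.I / 2)) • (Z - Zᴴ)).IsHermitian := by
  unfold Matrix.IsHermitian
  rw [conjTranspose_smul, conjTranspose_sub, conjTranspose_conjTranspose]
  rw [show star (-(Complex.I / 2)) = Complex.I / 2 by simp [div_eq_mul_inv, Complex.conj_I]]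
  rw [← neg_sub Z, smul_neg, ← neg_smul]

/-- [folklore] `Z = ½(Z + Zᴴ) + i · (−(i/2)(Z − Zᴴ))`. -/
theorem hermPart_add_I_smul_skewPart (Z : Matrix (Fin N) (Fin N) ℂ) :
    (1 / 2 : ℂ) • (Z + Zᴴ) + Complex.I • ((-(Complex.I / 2)) • (Z - Zᴴ)) = Z := by
  rw [smul_smul, show Complex.I * -(Complex.I / 2) = 1 / 2 by
    rw [mul_neg, mul_div_assoc', Complex.I_mul_I]; ring]
  rw [← smul_add, show Z + Zᴴ + (Z - Zᴴ) = (2 : ℂ) • Z by rw [two_smul]; abel, smul_smul]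
  norm_num

/-- [folklore] Traces of the two parts of a TRACELESS `Z` vanish. -/
theorem trace_hermPart_eq_zero {Z : Matrix (Fin N) (Fin N) ℂ} (hZ : trace Z = 0) : trace ((1 / 2 : ℂ) • (Z + Zᴴ)) = 0 := by
  rw [trace_smul, trace_add, trace_conjTranspose, hZ, star_zero, add_zero, smul_zero]

/-- [folklore] Traces of the two parts of a TRACELESS `Z` vanish. -/
theorem trace_skewPart_eq_zero {Z : Matrix (Fin N) (Fin N) ℂ} (hZ : trace Z = 0) :
    trace ((-(Complex.I / 2)) • (Z - Zᴴ)) = 0 := by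
  rw [trace_smul, trace_sub, trace_conjTranspose, hZ, star_zero, sub_zero, smul_zero]

/-- [folklore] Expansion of `X + i·Y` for hermitian traceless `X`, `Y` (complex linearity of `Z ↦ Σ_a Tr(Z·λ_a) • λ_a`). -/
theorem gellMann_expansion_add_I_smul {X Y : Matrix (Fin N) (Fin N) ℂ} (hX : X.IsHermitian) (hX0 : trace X = 0) (hY : Y.IsHermitian)
    (hY0 : trace Y = 0) : ∑ a, trace ((X + Complex.I • Y) * gellMann a) • gellMann a = X + Complex.I • Y := by
  calc ∑ a, trace ((X + Complex.I • Y) * gellMann a) • gellMann a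
      = ∑ a, (trace (X * gellMann a) • gellMann a + Complex.I • (trace (Y * gellMann a) • gellMann a)) := by
        refine Finset.sum_congr rfl fun a _ => ?_
        rw [Matrix.add_mul, Matrix.smul_mul, trace_add, trace_smul, smul_eq_mul, add_smul, mul_smul]
    _ = X + Complex.I • Y := by
        rw [Finset.sum_add_distrib, ← Finset.smul_sum, gellMann_expansion_of_isHermitian hX hX0,
          gellMann_expansion_of_isHermitian hY hY0]

/-- [folklore] **COMPLEX EXPANSION OF EVERY TRACELESS MATRIX IN THE GELL-MANN FAMILY**: `Σ_a Tr(Z·λ_a) • λ_a = Z` for all `Z ∈ 𝔰𝔩_N(ℂ)`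
(hermitian case `gellMann_complete`, extended by complex linearity through `Z = ½(Z + Zᴴ) + i·(−(i/2)(Z − Zᴴ))`). -/
theorem gellMann_expansion {Z : Matrix (Fin N) (Fin N) ℂ} (hZ : trace Z = 0) : ∑ a, trace (Z * gellMann a) • gellMann a = Z := by
  have h := gellMann_expansion_add_I_smul (isHermitian_hermPart Z) (trace_hermPart_eq_zero hZ) (isHermitian_skewPart Z)
    (trace_skewPart_eq_zero hZ)
  rwa [hermPart_add_I_smul_skewPart] at h

/-! ## §2 The rescaled family `suGen N := √N · gellMann` is tr-orthonormal and complete in the `ColourTrace` conventions -/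

variable (N) in
/-- [folklore] THE COLOUR FAMILY OF RECORD: `suGen N a := √N · gellMann a` (`a : GMIndex N`, `N² − 1` generators).  A definition
asserting nothing. -/
noncomputable def suGen : GMIndex N → Matrix (Fin N) (Fin N) ℂ := fun a => ((Real.sqrt N : ℝ) : ℂ) • gellMann a

/-- [folklore] Unfolding equation of `suGen`. -/
theorem suGen_apply (a : GMIndex N) : suGen N a = ((Real.sqrt N : ℝ) : ℂ) • gellMann a := rfl

/-- [folklore] `√N · √N = N` in `ℂ`. -/
theorem sqrt_mul_sqrt_natCast (N : ℕ) : ((Real.sqrt N : ℝ) : ℂ) * ((Real.sqrt N : ℝ) : ℂ) = (N : ℂ) := by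
  rw [← Complex.ofReal_mul, Real.mul_self_sqrt (Nat.cast_nonneg N), Complex.ofReal_natCast]

/-- [folklore] The generators `suGen N a` are traceless. -/
theorem trace_suGen (a : GMIndex N) : trace (suGen N a) = 0 := by
  rw [suGen_apply, trace_smul, (gellMann_mem a).2, smul_zero]

/-- [folklore] The generators `suGen N a` are hermitian. -/
theorem suGen_isHermitian (a : GMIndex N) : (suGen N a).IsHermitian := by
  rw [suGen_apply]
  unfold Matrix.IsHermitian
  rw [conjTranspose_smul, (gellMann_mem a).1.eq, Complex.star_def, Complex.conj_ofReal]

variable (N) in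
/-- [folklore] **`suGen N` IS TR-ORTHONORMAL** (`ColourTrace` convention (C2): `Tr τ_c τ_d = N·δ_cd`). -/
theorem suGen_trOrthonormal : TrOrthonormal (suGen N) := by
  intro c d
  rw [suGen_apply, suGen_apply, Matrix.smul_mul, Matrix.mul_smul, smul_smul, trace_smul, smul_eq_mul, sqrt_mul_sqrt_natCast,
    trace_gellMann_mul_gellMann]
  split_ifs <;> simp

/-- [folklore] **`suGen N` IS COMPLETE** (`ColourTrace` convention: `Σ_c (τ_c)_ij (τ_c)_kl = N·δ_jk δ_il − δ_ij δ_kl`), for every `N ≠ 0`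
(`ColourTrace.complete_of_expansion` fed with §1's complex expansion). -/
theorem suGen_complete (hN : N ≠ 0) : Complete (suGen N) := by
  refine complete_of_expansion hN trace_suGen fun Z hZ => ?_
  calc ∑ d, trace (Z * suGen N d) • suGen N d
      = (N : ℂ) • ∑ d, trace (Z * gellMann d) • gellMann d := by
        rw [Finset.smul_sum]
        refine Finset.sum_congr rfl fun d _ => ?_
        rw [suGen_apply, Matrix.mul_smul, trace_smul, smul_eq_mul, smul_smul, smul_smul, mul_right_comm, sqrt_mul_sqrt_natCast]
    _ = (N : ℂ) • Z := by rw [gellMann_expansion hZ]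

/-! ## §3 An external colour for `2 ≤ N` -/

/-- [folklore] A distinguished generator index (the first diagonal generator), available as soon as `2 ≤ N`.  A definition asserting
nothing. -/
def diagIndex (hN : 2 ≤ N) : GMIndex N := Sum.inr ⟨0, by omega⟩

/-- [folklore] `GMIndex N` is inhabited for `2 ≤ N`. -/
theorem nonempty_GMIndex (hN : 2 ≤ N) : Nonempty (GMIndex N) := ⟨diagIndex hN⟩

/-- [folklore] `2 ≤ N → N ≠ 0` (the side condition of the Wilson ENDs). -/
theorem ne_zero_of_two_le (hN : 2 ≤ N) : N ≠ 0 := by omega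

end Summit.QuantumFields.BalabanUV.Beta.ColourBasisSU
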